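import Summits.Parity.GeneralizedHardyLittlewood.Theorems.PrimeLevelFamEdgeMomentsBeyondDiagonalDiagRemDeformedLocal
import HarnessLib

/-!
# Route `PrimeLevelFamEdge`, crux K_A `MomentsBeyondDiagonal` (stmt-Parity-20007), line «petersson_layers» v4, stub `stub_diag`:
# **the `t`-deformed local factors on squarefree numbers: `H_n(u) = g_n(u)·S(u)`, `|η_n^{(c)}(u)| ≤ τ(u)gcd(n,u)(log u)^c/u²`**
# (brick D4a′ of «D4TAIL»; sequel of `…DiagRemDeformedLocal`)

On squarefree `u` the multiplicative `H_n = AE ∗ AE⁻ ∗ 𝔄_n` factors as `g_n(u)·S(u)` with the REAL multiplicative `g_n = id⁻¹ ∗ W_n`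
(`g_n(p) = 1/p + W_n(p) = 1/(p(p+1))` for `p ∤ n` — the cancellation that makes the local factors summable — and `1/p` for `p ∣ n`)
and `S(u) = Σ_{de=u} e^{X(log d − log e)}` (`|c!·[X^c]S(u)| ≤ τ(u)(log u)^c`).

* `mul_apply_prime'` — `(f ∗ g)(p) = f(1)g(p) + f(p)g(1)`;
* `isMultiplicative_Wn` — `W_n = 1_{(·,n)=1}W` is multiplicative;
* `H_apply_of_squarefree`, `abs_g_le_of_squarefree` (`0 ≤ g_n(u) ≤ gcd(n,u)/u²`), `abs_sum_divisorsAntidiagonal_logDiff_pow_le`;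
* `abs_eta_le_of_squarefree` — **the squarefree bound**; `abs_eta_mul_le_of_coprime` — **Leibniz splitting**
  `|η^{(c)}(ku)| ≤ Σ_i C(c,i)|η^{(i)}(k)||η^{(c−i)}(u)|` for coprime `k, u`.

Def-free; theorems only. Helper `--supports stmt-Parity-20007`; closes nothing; K_A, K_B and the Parity summit are NOT proved;
nothing about Landau–Siegel zeros.

## References
* E. Kowalski, P. Michel, J. VanderKam, J. reine angew. Math. 526 (2000), Prop. 5.1 p. 18.
  [cite: KowalskiMichelVanderKam2000, Prop. 5.1 — derivation (local factors of ν(s), absolute convergence)]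
-/

noncomputable section

open Finset Real ArithmeticFunction

namespace Summit.Parity.GeneralizedHardyLittlewood.Theorems.MomentsBeyondDiagonal.DiagCorner

open Literature.NumberTheory.LFunctions.KMV2000.MollifierMainTerm (W G invA)
open Summit.Parity.GeneralizedHardyLittlewood.Theorems.BeyondDiagonalBeatsQuarter.KernelFormXSq
  (copTauW copTauW_apply invA_apply' isMultiplicative_W' isMultiplicative_invA' abs_W_le)

/-! ### The squarefree evaluation `H_n(u) = g_n(u)·S(u)` -/

/-- `(f ∗ g)(p) = f(1)g(p) + f(p)g(1)` at a prime. [folklore] -/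
theorem mul_apply_prime' {R : Type*} [CommSemiring R] (f g : ArithmeticFunction R) {p : ℕ} (hp : p.Prime) :
    (f * g) p = f 1 * g p + f p * g 1 := by
  rw [mul_apply, Nat.sum_divisorsAntidiagonal fun a b ↦ f a * g b, Nat.Prime.divisors hp,
    Finset.sum_pair hp.one_lt.ne, Nat.div_one, Nat.div_self hp.pos]

/-- `W_n = 1_{(·,n)=1}·W` is a multiplicative real arithmetic function. [folklore] -/
theorem isMultiplicative_Wn (n : ℕ) : ArithmeticFunction.IsMultiplicative (R := ℝ)
      ⟨fun k ↦ if k.Coprime n then W k else 0, by split_ifs <;> simp⟩ := by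
  refine ⟨?_, fun {a b} hab ↦ ?_⟩
  · show (if (1 : ℕ).Coprime n then W 1 else 0) = 1
    rw [if_pos (Nat.coprime_one_left n), isMultiplicative_W'.map_one]
  · show (if (a * b).Coprime n then W (a * b) else 0) = (if a.Coprime n then W a else 0) * (if b.Coprime n then W b else 0)
    by_cases ha : a.Coprime n
    · by_cases hb : b.Coprime n
      · rw [if_pos (Nat.Coprime.mul_left ha hb), if_pos ha, if_pos hb, isMultiplicative_W'.map_mul_of_coprime hab]
      · have : ¬ (a * b).Coprime n := fun h ↦ hb (Nat.Coprime.coprime_mul_left h)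
        rw [if_neg this, if_neg hb, mul_zero]
    · have : ¬ (a * b).Coprime n := fun h ↦ ha (Nat.Coprime.coprime_mul_right h)
      rw [if_neg this, if_neg ha, zero_mul]

/-- **On squarefree `u`: `H_n(u) = g_n(u)·S(u)`**, `g_n = id⁻¹ ∗ W_n` (real, multiplicative), `S = E ∗ E⁻`. The prime case is the
cancellation `H_n(p) = (1/p + W_n(p))·(E(p) + E⁻(p))`. [cite: KowalskiMichelVanderKam2000, Prop. 5.1 — derivation (local factors)] -/
theorem H_apply_of_squarefree (n : ℕ) (AE AEm frakA E Em : ArithmeticFunction (PowerSeries ℝ)) (g : ArithmeticFunction ℝ)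
    (hAE : ∀ d : ℕ, AE d = PowerSeries.C ((d : ℝ)⁻¹) * PowerSeries.rescale (1 * Real.log d) (PowerSeries.exp ℝ))
    (hAEm : ∀ d : ℕ, AEm d = PowerSeries.C ((d : ℝ)⁻¹) * PowerSeries.rescale (-1 * Real.log d) (PowerSeries.exp ℝ))
    (hA : ∀ k : ℕ, frakA k = PowerSeries.C (if k.Coprime n then W k else 0) *
      ∑ z ∈ k.divisorsAntidiagonal, PowerSeries.rescale (1 * Real.log z.1) (PowerSeries.exp ℝ) *
        PowerSeries.rescale (-1 * Real.log z.2) (PowerSeries.exp ℝ))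
    (hE : ∀ d : ℕ, d ≠ 0 → E d = PowerSeries.rescale (1 * Real.log d) (PowerSeries.exp ℝ))
    (hEm : ∀ d : ℕ, d ≠ 0 → Em d = PowerSeries.rescale (-1 * Real.log d) (PowerSeries.exp ℝ))
    (hg : g = invA * ⟨fun k ↦ if k.Coprime n then W k else 0, by split_ifs <;> simp⟩)
    {u : ℕ} (hu : Squarefree u) :
    (AE * AEm * frakA) u = PowerSeries.C (g u) * (E * Em) u := by
  have hH := isMultiplicative_H n AE AEm frakA hAE hAEm hA
  have hS : (E * Em).IsMultiplicative := (isMultiplicative_expWeight 1 E hE).mul (isMultiplicative_expWeight (-1) Em hEm)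
  have hWn := isMultiplicative_Wn n
  have hgm : g.IsMultiplicative := by rw [hg]; exact isMultiplicative_invA'.mul hWn
  -- `S k = Σ_{z} e^{X log z₁}e^{−X log z₂}` (the `if`s resolve inside the antidiagonal)
  have hSk : ∀ k : ℕ, (E * Em) k = ∑ z ∈ k.divisorsAntidiagonal,
      PowerSeries.rescale (1 * Real.log z.1) (PowerSeries.exp ℝ) * PowerSeries.rescale (-1 * Real.log z.2) (PowerSeries.exp ℝ) := by
    intro k
    rw [mul_apply]
    refine Finset.sum_congr rfl fun z hz ↦ ?_
    obtain ⟨h1, h2⟩ := ne_zero_of_mem_divisorsAntidiagonal' hz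
    rw [hE z.1 h1, hEm z.2 h2]
  induction u using induction_on_primes with
  | zero => exact absurd hu not_squarefree_zero
  | one => rw [hH.map_one, hgm.map_one, hS.map_one, map_one, one_mul]
  | prime_mul p a hp ih =>
    have hcop : Nat.Coprime p a := Nat.coprime_of_squarefree_mul hu
    have ha : Squarefree a := hu.of_mul_right
    -- the prime value: `H(p) = C(1/p + W_n(p))·(E p + E⁻ p)`
    have hA1 : frakA 1 = 1 := (isMultiplicative_frakA n frakA hA).map_one
    have hAE1 : AE 1 = 1 := (isMultiplicative_AE 1 AE hAE).map_one
    have hAEm1 : AEm 1 = 1 := (isMultiplicative_AE (-1) AEm hAEm).map_one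
    have hp0 : p ≠ 0 := hp.ne_zero
    have hSp : (E * Em) p = PowerSeries.rescale (1 * Real.log p) (PowerSeries.exp ℝ) +
        PowerSeries.rescale (-1 * Real.log p) (PowerSeries.exp ℝ) := by
      rw [mul_apply_prime' E Em hp, hE 1 one_ne_zero, hEm 1 one_ne_zero, hE p hp0, hEm p hp0]
      simp [add_comm]
    have hgp : g p = (p : ℝ)⁻¹ + (if p.Coprime n then W p else 0) := by
      rw [hg, mul_apply_prime' _ _ hp, invA_apply', invA_apply']
      show ((1 : ℕ) : ℝ)⁻¹ * (if p.Coprime n then W p else 0) + (p : ℝ)⁻¹ * (if (1 : ℕ).Coprime n then W 1 else 0) = _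
      rw [if_pos (Nat.coprime_one_left n), isMultiplicative_W'.map_one]
      simp only [Nat.cast_one, inv_one, one_mul, mul_one]
      ring
    have hAA1 : (AE * AEm) 1 = 1 := ((isMultiplicative_AE 1 AE hAE).mul (isMultiplicative_AE (-1) AEm hAEm)).map_one
    have hHp : (AE * AEm * frakA) p = PowerSeries.C (g p) * (E * Em) p := by
      rw [mul_apply_prime' _ _ hp, mul_apply_prime' _ _ hp, hA1, hAE1, hAEm1, hAA1, hA p, ← hSk p, hSp, hgp, hAE p, hAEm p,
        map_add]
      simp only [one_mul, mul_one]
      ring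
    rw [hH.map_mul_of_coprime hcop, hgm.map_mul_of_coprime hcop, hS.map_mul_of_coprime hcop, hHp, ih ha, map_mul]
    ring

/-- **`0 ≤ g_n(u) ≤ gcd(n,u)/u²` on squarefree `u`** (`g_n = id⁻¹ ∗ W_n`; `g_n(p) = 1/(p(p+1))` if `p ∤ n`, `1/p` if `p ∣ n`).
[cite: KowalskiMichelVanderKam2000, Prop. 5.1 — derivation (local factors)] -/
theorem abs_g_le_of_squarefree (n : ℕ) (g : ArithmeticFunction ℝ)
    (hg : g = invA * ⟨fun k ↦ if k.Coprime n then W k else 0, by split_ifs <;> simp⟩) {u : ℕ} (hu : Squarefree u) :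
    0 ≤ g u ∧ g u ≤ (Nat.gcd n u : ℝ) / (u : ℝ) ^ 2 := by
  have hWn := isMultiplicative_Wn n
  have hgm : g.IsMultiplicative := by rw [hg]; exact isMultiplicative_invA'.mul hWn
  induction u using induction_on_primes with
  | zero => exact absurd hu not_squarefree_zero
  | one => rw [hgm.map_one]; simp
  | prime_mul p a hp ih =>
    have hcop : Nat.Coprime p a := Nat.coprime_of_squarefree_mul hu
    have ha : Squarefree a := hu.of_mul_right
    obtain ⟨ih0, ih1⟩ := ih ha
    have hp0 : (0 : ℝ) < p := by exact_mod_cast hp.pos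
    have ha0 : (0 : ℝ) < a := by exact_mod_cast Nat.pos_of_ne_zero ha.ne_zero
    -- the prime value and its bound
    have hgp : g p = (p : ℝ)⁻¹ + (if p.Coprime n then W p else 0) := by
      rw [hg, mul_apply_prime' _ _ hp, invA_apply', invA_apply']
      show ((1 : ℕ) : ℝ)⁻¹ * (if p.Coprime n then W p else 0) + (p : ℝ)⁻¹ * (if (1 : ℕ).Coprime n then W 1 else 0) = _
      rw [if_pos (Nat.coprime_one_left n), isMultiplicative_W'.map_one]
      simp only [Nat.cast_one, inv_one, one_mul, mul_one]
      ring
    have hWp : W p = -((p : ℝ) + 1)⁻¹ := by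
      have h := Summit.Parity.GeneralizedHardyLittlewood.Theorems.BeyondDiagonalBeatsQuarter.KernelFormXSq.W_apply_prime_pow'
        (i := 1) hp one_ne_zero
      rw [pow_one, if_pos rfl] at h
      exact h
    have hgp' : 0 ≤ g p ∧ g p ≤ (Nat.gcd n p : ℝ) / (p : ℝ) ^ 2 := by
      rw [hgp]
      by_cases hpn : p.Coprime n
      · rw [if_pos hpn, hWp]
        have hg1 : Nat.gcd n p = 1 := Nat.Coprime.gcd_eq_one hpn.symm
        rw [hg1, Nat.cast_one]
        constructor
        · rw [← one_div, ← one_div]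
          have : 1 / ((p : ℝ) + 1) ≤ 1 / (p : ℝ) := one_div_le_one_div_of_le hp0 (by linarith)
          linarith
        · have h1 : (p : ℝ)⁻¹ + -((p : ℝ) + 1)⁻¹ = 1 / ((p : ℝ) * ((p : ℝ) + 1)) := by
            field_simp; ring
          rw [h1]
          exact one_div_le_one_div_of_le (by positivity) (by nlinarith)
      · rw [if_neg hpn, add_zero]
        have hdvd : p ∣ n := by
          by_contra h
          exact hpn ((Nat.Prime.coprime_iff_not_dvd hp).2 h)
        have hg1 : Nat.gcd n p = p := Nat.gcd_eq_right hdvd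
        rw [hg1]
        constructor
        · positivity
        · rw [sq, div_eq_mul_inv, mul_inv, ← mul_assoc, mul_inv_cancel₀ hp0.ne', one_mul]
    rw [hgm.map_mul_of_coprime hcop, Nat.Coprime.gcd_mul n hcop]
    push_cast
    refine ⟨mul_nonneg hgp'.1 ih0, ?_⟩
    calc g p * g a ≤ ((Nat.gcd n p : ℝ) / (p : ℝ) ^ 2) * ((Nat.gcd n a : ℝ) / (a : ℝ) ^ 2) :=
          mul_le_mul hgp'.2 ih1 ih0 (by positivity)
      _ = (Nat.gcd n p : ℝ) * (Nat.gcd n a) / ((p : ℝ) * a) ^ 2 := by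
          field_simp

/-- `|c!·[X^c]S(u)| = |Σ_{de=u}(log d − log e)^c| ≤ τ(u)·(log u)^c` (`u ≥ 1`). [folklore] -/
theorem abs_sum_divisorsAntidiagonal_logDiff_pow_le (u c : ℕ) :
    |∑ x ∈ u.divisorsAntidiagonal, (Real.log x.1 - Real.log x.2) ^ c| ≤ (u.divisors.card : ℝ) * Real.log u ^ c := by
  have hterm : ∀ x ∈ u.divisorsAntidiagonal, |(Real.log x.1 - Real.log x.2) ^ c| ≤ Real.log u ^ c := by
    intro x hx
    have hx' := Nat.mem_divisorsAntidiagonal.1 hx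
    obtain ⟨h1, h2⟩ := ne_zero_of_mem_divisorsAntidiagonal' hx
    have l1 : 0 ≤ Real.log (x.1 : ℝ) := Real.log_natCast_nonneg _
    have l2 : 0 ≤ Real.log (x.2 : ℝ) := Real.log_natCast_nonneg _
    have hsum : Real.log (x.1 : ℝ) + Real.log x.2 = Real.log u := by
      rw [← Real.log_mul (by exact_mod_cast h1) (by exact_mod_cast h2), ← Nat.cast_mul, hx'.1]
    rw [abs_pow]
    refine pow_le_pow_left₀ (abs_nonneg _) ?_ c
    rw [abs_le]; constructor <;> linarith
  refine (Finset.abs_sum_le_sum_abs _ _).trans ((Finset.sum_le_sum hterm).trans ?_)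
  rw [Finset.sum_const, nsmul_eq_mul]
  have h := Nat.sum_divisorsAntidiagonal (n := u) (fun _ _ ↦ (1 : ℝ))
  simp only [Finset.sum_const, nsmul_eq_mul, mul_one] at h
  rw [h]

/-- **The squarefree bound `|η_n^{(c)}(u)| ≤ τ(u)·gcd(n,u)·(log u)^c/u²`** (squarefree `u`; this is where the cancellation
`1/p + W(p) = 1/(p(p+1))` enters). [cite: KowalskiMichelVanderKam2000, Prop. 5.1 — derivation (local factors)] -/
theorem abs_eta_le_of_squarefree (n c : ℕ) (AE AEm frakA : ArithmeticFunction (PowerSeries ℝ))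
    (hAE : ∀ d : ℕ, AE d = PowerSeries.C ((d : ℝ)⁻¹) * PowerSeries.rescale (1 * Real.log d) (PowerSeries.exp ℝ))
    (hAEm : ∀ d : ℕ, AEm d = PowerSeries.C ((d : ℝ)⁻¹) * PowerSeries.rescale (-1 * Real.log d) (PowerSeries.exp ℝ))
    (hA : ∀ k : ℕ, frakA k = PowerSeries.C (if k.Coprime n then W k else 0) *
      ∑ z ∈ k.divisorsAntidiagonal, PowerSeries.rescale (1 * Real.log z.1) (PowerSeries.exp ℝ) *
        PowerSeries.rescale (-1 * Real.log z.2) (PowerSeries.exp ℝ))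
    {u : ℕ} (hu : Squarefree u) :
    |(c.factorial : ℝ) * PowerSeries.coeff c ((AE * AEm * frakA) u)| ≤
      (u.divisors.card : ℝ) * (Nat.gcd n u) * Real.log u ^ c / (u : ℝ) ^ 2 := by
  classical
  set E : ArithmeticFunction (PowerSeries ℝ) :=
    ⟨fun d ↦ if d = 0 then 0 else PowerSeries.rescale (1 * Real.log d) (PowerSeries.exp ℝ), if_pos rfl⟩ with hEdef
  set Em : ArithmeticFunction (PowerSeries ℝ) :=
    ⟨fun d ↦ if d = 0 then 0 else PowerSeries.rescale (-1 * Real.log d) (PowerSeries.exp ℝ), if_pos rfl⟩ with hEmdef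
  have hE : ∀ d : ℕ, d ≠ 0 → E d = PowerSeries.rescale (1 * Real.log d) (PowerSeries.exp ℝ) := fun d hd ↦ by
    rw [hEdef]; exact if_neg hd
  have hEm : ∀ d : ℕ, d ≠ 0 → Em d = PowerSeries.rescale (-1 * Real.log d) (PowerSeries.exp ℝ) := fun d hd ↦ by
    rw [hEmdef]; exact if_neg hd
  set g : ArithmeticFunction ℝ := invA * ⟨fun k ↦ if k.Coprime n then W k else 0, by split_ifs <;> simp⟩ with hg
  have hu0 : u ≠ 0 := hu.ne_zero
  have hu0' : (0 : ℝ) < u := by exact_mod_cast Nat.pos_of_ne_zero hu0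
  rw [H_apply_of_squarefree n AE AEm frakA E Em g hAE hAEm hA hE hEm hg hu, PowerSeries.coeff_C_mul,
    coeff_symmKernel E Em hE hEm u c]
  obtain ⟨hg0, hg1⟩ := abs_g_le_of_squarefree n g hg hu
  have hS := abs_sum_divisorsAntidiagonal_logDiff_pow_le u c
  have hfac : (c.factorial : ℝ) ≠ 0 := by positivity
  have hrew : (c.factorial : ℝ) * (g u * ∑ x ∈ u.divisorsAntidiagonal, (Real.log x.1 - Real.log x.2) ^ c / (c.factorial : ℝ)) =
      g u * ∑ x ∈ u.divisorsAntidiagonal, (Real.log x.1 - Real.log x.2) ^ c := by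
    rw [← Finset.sum_div]; field_simp
  rw [hrew, abs_mul, abs_of_nonneg hg0]
  calc g u * |∑ x ∈ u.divisorsAntidiagonal, (Real.log x.1 - Real.log x.2) ^ c|
      ≤ ((Nat.gcd n u : ℝ) / (u : ℝ) ^ 2) * ((u.divisors.card : ℝ) * Real.log u ^ c) :=
        mul_le_mul hg1 hS (abs_nonneg _) (by positivity)
    _ = _ := by ring

/-! ### Splitting `η^{(c)}` over a coprime factorisation -/

/-- **`|η^{(c)}(ku)| ≤ Σ_{i ≤ c} C(c,i)·|η^{(i)}(k)|·|η^{(c−i)}(u)|` for coprime `k, u`** (multiplicativity of `H_n` and the Leibniz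
rule for `X`-coefficients). [folklore] -/
theorem abs_eta_mul_le_of_coprime (H : ArithmeticFunction (PowerSeries ℝ)) (hH : H.IsMultiplicative) (c : ℕ)
    {k u : ℕ} (hku : Nat.Coprime k u) :
    |(c.factorial : ℝ) * PowerSeries.coeff c (H (k * u))| ≤
      ∑ i ∈ Finset.range (c + 1), (Nat.choose c i : ℝ) *
        (|(i.factorial : ℝ) * PowerSeries.coeff i (H k)| * |((c - i).factorial : ℝ) * PowerSeries.coeff (c - i) (H u)|) := by
  rw [hH.map_mul_of_coprime hku, PowerSeries.coeff_mul,
    Finset.Nat.sum_antidiagonal_eq_sum_range_succ (fun i j ↦ PowerSeries.coeff i (H k) * PowerSeries.coeff j (H u)) c,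
    Finset.mul_sum]
  refine (Finset.abs_sum_le_sum_abs _ _).trans (Finset.sum_le_sum fun i hi ↦ ?_)
  have hi' : i ≤ c := Nat.lt_succ_iff.mp (Finset.mem_range.mp hi)
  have hchoose : (c.factorial : ℝ) = (Nat.choose c i : ℝ) * (i.factorial * (c - i).factorial) := by
    rw [← Nat.choose_mul_factorial_mul_factorial hi']; push_cast; ring
  rw [hchoose]
  simp only [abs_mul, Nat.abs_cast]
  apply le_of_eq; ring

end Summit.Parity.GeneralizedHardyLittlewood.Theorems.MomentsBeyondDiagonal.DiagCorner

end
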